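import Mathlib
import Literature.Barriers.ValiantsHypothesis.MonotoneGapMatrixTree
import Summits.ValiantsHypothesis.ValiantsHypothesis.Theorems.DivisionGapSensitiveStDivisionEasyElim

/-!
# Determinant bookkeeping for the star–mesh elimination (support of `SensitiveStDivisionEasy`)

Support file for item `stmt-ValiantsHypothesis-10464` (route DivisionGap), continuing
`DivisionGapSensitiveStDivisionEasyElim.lean`:

* closed forms of the accumulators: `ps_k = ∏_{j<k} S_j`, `pr_k = ps_k + u_k` (the telescoping),
  `F = Σ_t ∏_i x_{(i,t i)} = ∏_{j<N} r_j`;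
* over a commutative RING `R`: `D 0 = ST` by the tree's directed matrix-tree theorem
  (`Literature.Barriers.ValiantsHypothesis.det_stLaplacian`), `D N = 1`, and the
  Schur-complement step `S_κ^{#live'} · D κ = S_κ · D (κ+1)` (`S_pow_mul_D`), from the block
  identity `[[1,0],[-c, S·1]] · [[S, r],[c, M]] = [[S, r],[0, S·M - c r]]` and the observation
  that `S·M - c r` is the reduced Laplacian of the star–meshed weights (`schur_eq_lapLive_succ`);
* the resulting polynomial identities `ST · ∏_{j<N} ∏_{i<j} S_i = ∏_{j<N} S_j`
  (`stPoly_mul_prod`), `Σ_v w^{(k)}_{iv} = ps_k · r_i` (`rowSum_eq`) and finally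
  `ST · pr_N = F · ps_N` (`stPoly_mul_pr`).
-/

noncomputable section

-- `Summit.<Summit>.<Problem>` repeats `ValiantsHypothesis` by the tree's layout convention (D-0017).
set_option linter.dupNamespace false

namespace Summit.ValiantsHypothesis.ValiantsHypothesis.Theorems

namespace SensitiveStElim

open MvPolynomial Finset Matrix Literature.Barriers.ValiantsHypothesis

universe u

/-! ### Closed forms of the accumulators, and the polynomial `F` -/

section Accumulators

variable {R : Type u} [CommSemiring R] {N : ℕ}

/-- `F = ∏_{j<N} r_j` with `ℕ`-indexed factors. -/
theorem fPoly_eq_prod_range : fPoly R N = ∏ j ∈ range N, rowX' R N j := by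
  rw [fPoly, ← Fin.prod_univ_eq_prod_range (fun j => rowX' R N j) N]
  refine Finset.prod_congr rfl fun i _ => ?_
  simp [rowX', i.isLt]

/-- `F = Σ_t ∏_i x_{(i, t i)}` (expand the product of the row sums). -/
theorem fPoly_eq_sum : fPoly R N = ∑ t : Fin N → Option (Fin N), ∏ i : Fin N, X (i, t i) := by
  rw [fPoly]
  unfold rowX
  rw [Finset.prod_univ_sum, Fintype.piFinset_univ]

/-- `ps_k = ∏_{j<k} S_j`. -/
theorem ps_eq (k : ℕ) : val R N k (Sum.inr 0) = ∏ j ∈ range k, S' R N j := by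
  induction k with
  | zero => simp
  | succ k ih =>
    rw [Finset.prod_range_succ, ← ih]
    rcases Nat.lt_or_ge k N with hk | hk
    · rw [S', dif_pos hk]
      exact val_succ_ps ⟨k, hk⟩
    · rw [S', dif_neg (not_lt.mpr hk), val_succ_of_le hk, mul_one]

/-- `pr_k = ps_k + u_k` (the telescoping, accumulated). -/
theorem pr_eq_ps_add_u (k : ℕ) :
    val R N k (Sum.inr 1) = val R N k (Sum.inr 0) + val R N k (Sum.inr 2) := by
  induction k with
  | zero => simp
  | succ k ih =>
    rcases Nat.lt_or_ge k N with hk | hk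
    · rw [val_succ_pr ⟨k, hk⟩, val_succ_ps ⟨k, hk⟩, val_succ_u ⟨k, hk⟩, Rt_eq]
      rw [ih]
      ring
    · rw [val_succ_of_le hk, val_succ_of_le hk, val_succ_of_le hk, ih]

end Accumulators

/-! ### `D 0 = ST`, `D N = 1` -/

variable {R : Type u} [CommRing R] {N : ℕ}

/-- At level `0` the Laplacian is the tree's `stLaplacian`. -/
theorem lap_zero : lap R N 0 = stLaplacian R N := by
  ext i j
  simp only [lap, stLaplacian, Matrix.of_apply, val_zero_inl]

/-- Hence `D 0 = ST` (directed matrix-tree theorem, `det_stLaplacian`). -/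
theorem D_zero : D R N 0 = stPoly R N := by
  have h := Matrix.det_submatrix_equiv_self
    (Equiv.subtypeUnivEquiv (fun i : Fin N => Nat.zero_le (i : ℕ)) : Live N 0 ≃ Fin N)
    (lap R N 0)
  rw [lap_zero (R := R) (N := N)] at h
  rw [← det_stLaplacian, ← h]
  rfl

/-- After the last elimination nothing is live: `D N = 1`. -/
theorem D_last : D R N N = 1 := by
  haveI : IsEmpty (Live N N) := ⟨fun i => absurd i.2 (not_le.mpr i.1.isLt)⟩
  exact Matrix.det_isEmpty

/-! ### One Schur-complement step -/

/-- Diagonal entries of `lap`. -/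
theorem lap_self (k : ℕ) (i : Fin N) :
    lap R N k i i = ∑ v ∈ univ.erase (some i), val R N k (Sum.inl (i, v)) := by
  simp [lap]

/-- Off-diagonal entries of `lap`. -/
theorem lap_of_ne (k : ℕ) {i j : Fin N} (h : i ≠ j) :
    lap R N k i j = -val R N k (Sum.inl (i, some j)) := by
  simp [lap, h]

/-- The pivot entry is `S_κ`. -/
theorem lap_pivot (κ : Fin N) : lap R N κ κ κ = S κ := by
  rw [lap_self]; rfl

/-- Diagonal entries after eliminating `κ`: `L'_{ii} = S_κ L_{ii} - L_{iκ} L_{κi}`. -/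
theorem lap_succ_self (κ : Fin N) {i : Fin N} (hi : i ≠ κ) :
    lap R N (κ + 1) i i = S κ * lap R N κ i i - lap R N κ i κ * lap R N κ κ i := by
  rw [lap_self, lap_self, lap_of_ne _ hi, lap_of_ne _ (Ne.symm hi)]
  have hκi : some κ ∈ univ.erase (some i) := by
    simpa using fun h => hi (Option.some_injective _ h).symm
  have hiκ : some i ∈ univ.erase (some κ) := by
    simpa using fun h => hi (Option.some_injective _ h)
  simp_rw [val_succ_inl]
  rw [← Finset.sum_erase (univ.erase (some i)) (a := some κ) (by simp)]
  rw [Finset.sum_congr rfl (fun v hv => if_neg (Finset.ne_of_mem_erase hv)),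
    Finset.sum_add_distrib, ← Finset.mul_sum, ← Finset.mul_sum,
    Finset.sum_erase_eq_sub hκi, Finset.erase_right_comm, Finset.sum_erase_eq_sub hiκ]
  unfold S
  ring

/-- Off-diagonal entries after eliminating `κ`: `L'_{ij} = S_κ L_{ij} - L_{iκ} L_{κj}`. -/
theorem lap_succ_of_ne (κ : Fin N) {i j : Fin N} (hij : i ≠ j) (hi : i ≠ κ) (hj : j ≠ κ) :
    lap R N (κ + 1) i j = S κ * lap R N κ i j - lap R N κ i κ * lap R N κ κ j := by
  rw [lap_of_ne _ hij, lap_of_ne _ hij, lap_of_ne _ hi, lap_of_ne _ (Ne.symm hj), val_succ_inl,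
    if_neg (fun h => hj (Option.some_injective _ h))]
  ring

/-- The live Laplacian at level `κ`, reindexed pivot-first, in block form. -/
theorem reindex_lapLive (κ : Fin N) :
    Matrix.reindex (splitEquiv N κ) (splitEquiv N κ) (lapLive R N κ) =
      Matrix.fromBlocks (blkA R N κ) (blkB R N κ) (blkC R N κ) (blkD R N κ) := by
  ext (_ | i) (_ | j) <;> rfl

/-- The block identity `[[1,0],[-c, S·1]] · [[S, r],[c, M]] = [[S, r],[0, S·M - c r]]`. -/
theorem blocks_mul (κ : Fin N) :
    Matrix.fromBlocks (1 : Matrix Unit Unit (MvPolynomial (Edge N) R)) 0 (-blkC R N κ)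
          (S (R := R) κ •
            (1 : Matrix (Live N (κ + 1)) (Live N (κ + 1)) (MvPolynomial (Edge N) R))) *
        Matrix.fromBlocks (blkA R N κ) (blkB R N κ) (blkC R N κ) (blkD R N κ) =
      Matrix.fromBlocks (blkA R N κ) (blkB R N κ) 0
        (S (R := R) κ • blkD R N κ - blkC R N κ * blkB R N κ) := by
  rw [Matrix.fromBlocks_multiply]
  congr 1
  · simp
  · simp
  · rw [Matrix.smul_mul, Matrix.one_mul, Matrix.neg_mul]
    ext i u
    simp only [Matrix.add_apply, Matrix.neg_apply, Matrix.smul_apply, Matrix.mul_apply,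
      Fintype.sum_unique, blkA, blkC, Matrix.of_apply, lap_pivot, smul_eq_mul, Matrix.zero_apply]
    ring
  · rw [Matrix.smul_mul, Matrix.one_mul, Matrix.neg_mul]
    exact neg_add_eq_sub _ _

/-- The scaled Schur complement `S·M - c r` is the live Laplacian of the star–meshed weights. -/
theorem schur_eq_lapLive_succ (κ : Fin N) :
    S (R := R) κ • blkD R N κ - blkC R N κ * blkB R N κ = lapLive R N (κ + 1) := by
  ext i j
  have hi : i.1 ≠ κ := fun h => by have := i.2; rw [h] at this; simp at this
  have hj : j.1 ≠ κ := fun h => by have := j.2; rw [h] at this; simp at this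
  simp only [Matrix.sub_apply, Matrix.smul_apply, Matrix.mul_apply, blkD, blkC, blkB, lapLive,
    Matrix.of_apply, Matrix.submatrix_apply, Fintype.univ_ofSubsingleton, Finset.sum_singleton,
    smul_eq_mul]
  by_cases h : i.1 = j.1
  · rw [h, lap_succ_self κ hj]
  · rw [lap_succ_of_ne κ h hi hj]

/-- **The Schur-complement step**: `S_κ^{#live'} · D κ = S_κ · D (κ+1)` — eliminating the pivot
row scales each of the `#live'` remaining rows by `S_κ`. -/
theorem S_pow_mul_D (κ : Fin N) :
    S κ ^ Fintype.card (Live N (κ + 1)) * D R N κ = S κ * D R N (κ + 1) := by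
  have h := congrArg Matrix.det (blocks_mul (R := R) κ)
  rw [Matrix.det_mul, Matrix.det_fromBlocks_zero₁₂, Matrix.det_fromBlocks_zero₂₁,
    ← reindex_lapLive, Matrix.det_reindex_self, schur_eq_lapLive_succ, Matrix.det_one, one_mul,
    Matrix.det_smul, Matrix.det_one, mul_one, Matrix.det_unique (blkA R N κ)] at h
  simpa [blkA, lap_pivot, D] using h

/-! ### The invariant -/

/-- Downward invariant of the elimination:
`D k · ∏_{k ≤ j < N} ∏_{k ≤ i < j} S_i = ∏_{k ≤ j < N} S_j`. -/
theorem D_mul_prod (d : ℕ) : ∀ k, k + d = N →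
    D R N k * ∏ j ∈ Ico k N, ∏ i ∈ Ico k j, S' R N i = ∏ j ∈ Ico k N, S' R N j := by
  induction d with
  | zero =>
    intro k hk
    rw [add_zero] at hk
    subst hk
    simp [D_last]
  | succ d ih =>
    intro k hk
    have hkN : k < N := by omega
    have ih' := ih (k + 1) (by omega)
    have hstep := S_pow_mul_D (R := R) (⟨k, hkN⟩ : Fin N)
    rw [card_Live] at hstep
    have hsplit : ∏ j ∈ Ico k N, ∏ i ∈ Ico k j, S' R N i =
        S' R N k ^ (N - (k + 1)) * ∏ j ∈ Ico (k + 1) N, ∏ i ∈ Ico (k + 1) j, S' R N i := by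
      rw [Finset.prod_eq_prod_Ico_succ_bot hkN, Finset.Ico_self, Finset.prod_empty, one_mul]
      rw [Finset.prod_congr rfl (fun j hj =>
        Finset.prod_eq_prod_Ico_succ_bot (Finset.mem_Ico.mp hj).1 (fun i => S' R N i))]
      rw [Finset.prod_mul_distrib, Finset.prod_const, Nat.card_Ico]
    rw [hsplit, Finset.prod_eq_prod_Ico_succ_bot hkN, ← ih', ← mul_assoc]
    have hS : S' R N k = S ⟨k, hkN⟩ := S'_eq ⟨k, hkN⟩
    rw [hS, mul_comm (D R N k), hstep]
    ring

/-- **`ST · ∏_{j<N} ∏_{i<j} S_i = ∏_{j<N} S_j`.** -/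
theorem stPoly_mul_prod :
    stPoly R N * ∏ j ∈ range N, ∏ i ∈ range j, S' R N i = ∏ j ∈ range N, S' R N j := by
  have h := D_mul_prod (R := R) (N := N) N 0 (zero_add N)
  simp only [Nat.Ico_zero_eq_range] at h
  rwa [D_zero] at h

/-! ### Row masses and the final identity -/

/-- Row masses are only rescaled by the pivots: `Σ_v w^{(k)}_{iv} = ps_k · r_i`. -/
theorem rowSum_eq (k : ℕ) (i : Fin N) :
    ∑ v : Option (Fin N), val R N k (Sum.inl (i, v)) = val R N k (Sum.inr 0) * rowX R N i := by
  induction k with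
  | zero => simp [rowX]
  | succ k ih =>
    rcases Nat.lt_or_ge k N with hk | hk
    · have hps := val_succ_ps (R := R) ⟨k, hk⟩
      rw [hps, mul_right_comm, ← ih]
      simp_rw [show ∀ v, val R N (k + 1) (Sum.inl (i, v)) = _ from
        fun v => val_succ_inl (R := R) ⟨k, hk⟩ i v]
      rw [← Finset.sum_erase univ (a := some (⟨k, hk⟩ : Fin N)) (by simp),
        Finset.sum_congr rfl (fun v hv => if_neg (Finset.ne_of_mem_erase hv)),
        Finset.sum_add_distrib, ← Finset.mul_sum, ← Finset.mul_sum,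
        Finset.sum_erase_eq_sub (mem_univ _)]
      unfold S
      ring
    · rw [val_succ_of_le hk]
      simp_rw [val_succ_of_le hk]
      exact ih

/-- `pr_k = (∏_{j<k} ps_j) · ∏_{j<k} r_j` for `k ≤ N`. -/
theorem pr_eq : ∀ k, k ≤ N →
    val R N k (Sum.inr 1) =
      (∏ j ∈ range k, val R N j (Sum.inr 0)) * ∏ j ∈ range k, rowX' R N j := by
  intro k
  induction k with
  | zero => intro; simp
  | succ k ih =>
    intro hk
    have hkN : k < N := hk
    have hpr := val_succ_pr (R := R) ⟨k, hkN⟩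
    rw [hpr, ih hkN.le, Finset.prod_range_succ, Finset.prod_range_succ, Rt, rowSum_eq, rowX',
      dif_pos hkN]
    ring

/-- **`ST · pr_N = F · ps_N`**: the spanning-tree polynomial times the product of the row masses
met along the elimination is the full polynomial times the product of the pivots. -/
theorem stPoly_mul_pr :
    stPoly R N * val R N N (Sum.inr 1) = fPoly R N * val R N N (Sum.inr 0) := by
  rw [pr_eq N le_rfl, Finset.prod_congr rfl (fun j _ => ps_eq (R := R) (N := N) j), ← mul_assoc,
    stPoly_mul_prod, ps_eq, fPoly_eq_prod_range, mul_comm]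

end SensitiveStElim

end Summit.ValiantsHypothesis.ValiantsHypothesis.Theorems
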